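import Summits.ValiantsHypothesis.ValiantsHypothesis.Theorems.LacunarySymmetroidMatrixDescartesCensusDoorBBridge

/-!
# `MatrixDescartes` census — door B on the FAR-TOP class-G road: the uniform window theorem (word `DIIID`)

HONEST FRAMING.  Object-search cell `pub-symmetroid`, route crux `Theses.LacunarySymmetroid.MatrixDescartes`
(ledger item stmt-ValiantsHypothesis-18050).  Companion of `…CensusDoorBBridge.lean` (engine-1 g15): there the
kernel THEOREM L-N (a) (`Census.newton_s0_window`, engine-1 g14 / engine-6 g16) became a theorem about PENCILS
(`Census.doorB_window_of_newtonGood`) with a support-only Newton hypothesis decidable per support; this file states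
it UNIFORMLY on far-top class-G supports, `…CensusDoorBFarTopMono.lean` discharges the hypothesis on whole families.
* `doorB_word_farTop` — for a far-top class-G support `(0,d₁,d₂,d₃,d₄)` (`0 < d₁ < d₂ < 2d₁`, `2d₂ < d₃`,
  `2d₃ < d₄`; the fifteen pair sums are then distinct and sorted as
  `E = (0,d₁,d₂,2d₁,d₁+d₂,2d₂,d₃,d₁+d₃,d₂+d₃,2d₃,d₄,d₁+d₄,d₂+d₄,d₃+d₄,2d₄)`): if the Newton integer condition
  `P₀P₂P₃P₄ + P₁P₂²P₃ ≤ P₀P₁P₄²` holds (`P_k = ∏_{j≠k}|E_k − E_j|` over `Fin 15`), every real symmetric `2 × 2` pencil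
  on the support with `≥ 14` distinct positive determinant roots has word `D I I I D`.  Helpers `intCast_natDist`,
  `prod_univ_erase_eq_prod_ite_int`, `vec5_mk_vals`, `farTop_sq_uncollided`, `farTop_pair_uncollided`,
  `farTop_strictMono`, `farTop_image`.
* `farTop_weight_0` … `farTop_weight_4` — the five weights as (low part) × `∏_i (U_i − E_k)` over the nine upper
  knots `U = (d₃, d₁+d₃, d₂+d₃, 2d₃, d₄, d₁+d₄, d₂+d₄, d₃+d₄, 2d₄)`.
In the cell's dictionary: on a Newton-good far-top support DOOR B (a hypothetical II-ended `(2,5)` fourteen) is EMPTY,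
as a theorem about pencils.  The `(0,4,5,11,N)` column and the κ-corner are NOT Newton-good (certificate territory).
Nothing here bears on `ζ_sym`, `DoorA26` / `DoorA34` (OPEN), the crux `MatrixDescartes` or `VP ≠ VNP`.
[folklore] — elementary (engine-1 g14 THEOREM L-N / STRUCTURE §8, kernel form engine-1 g15).
-/

-- `Summit.ValiantsHypothesis.ValiantsHypothesis.…` repeats a component by the D-0017 layout
-- (single-conjunct summit), which the `dupNamespace` linter flags; the name is mandated.
set_option linter.dupNamespace false

namespace Summit.ValiantsHypothesis.ValiantsHypothesis.Theorems.LacunarySymmetroidMatrixDescartes.Census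

open Polynomial Finset
open scoped BigOperators Polynomial Matrix

/-- `Nat.dist` cast to `ℤ` is the absolute difference: `(Nat.dist m n : ℤ) = |(m : ℤ) − n|`. [folklore] -/
theorem intCast_natDist (m n : ℕ) : ((Nat.dist m n : ℕ) : ℤ) = |(m : ℤ) - n| := by
  rcases le_total m n with h | h
  · rw [Nat.dist_eq_sub_of_le h, Nat.cast_sub h, abs_sub_comm, abs_of_nonneg (by omega)]
  · rw [Nat.dist_comm, Nat.dist_eq_sub_of_le h, Nat.cast_sub h, abs_of_nonneg (by omega)]

/-- Finite products over `univ.erase t` as full products with the `t`-factor replaced by `1` (integer version of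
`prod_univ_erase_eq_prod_ite`). [folklore] -/
theorem prod_univ_erase_eq_prod_ite_int {n : ℕ} (t : Fin n) (g : Fin n → ℤ) :
    ∏ u ∈ univ.erase t, g u = ∏ u, (if u = t then 1 else g u) := by
  rw [← Finset.prod_erase (s := univ) (f := fun u => if u = t then 1 else g u) (a := t) (by simp)]
  exact Finset.prod_congr rfl (fun u hu => by rw [if_neg (Finset.ne_of_mem_erase hu)])

/-- The five entries of the exponent vector `![0, d₁, d₂, d₃, d₄]` at `Fin.mk` literals (for `simp` after
`fin_cases`). [folklore] -/
theorem vec5_mk_vals (d₁ d₂ d₃ d₄ : ℕ) :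
    (∀ h, (![0, d₁, d₂, d₃, d₄] : Fin 5 → ℕ) ⟨0, h⟩ = 0) ∧ (∀ h, (![0, d₁, d₂, d₃, d₄] : Fin 5 → ℕ) ⟨1, h⟩ = d₁) ∧
    (∀ h, (![0, d₁, d₂, d₃, d₄] : Fin 5 → ℕ) ⟨2, h⟩ = d₂) ∧ (∀ h, (![0, d₁, d₂, d₃, d₄] : Fin 5 → ℕ) ⟨3, h⟩ = d₃) ∧
    (∀ h, (![0, d₁, d₂, d₃, d₄] : Fin 5 → ℕ) ⟨4, h⟩ = d₄) :=
  ⟨fun _ => rfl, fun _ => rfl, fun _ => rfl, fun _ => rfl, fun _ => rfl⟩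

/-- On a far-top class-G support `(0,d₁,d₂,d₃,d₄)` (`0 < d₁ < d₂ < 2d₁`, `2d₂ < d₃`, `2d₃ < d₄`) every SQUARE knot
`2d_i` is uncollided among the pair sums. [folklore] -/
theorem farTop_sq_uncollided (d₁ d₂ d₃ d₄ : ℕ) (h1 : 0 < d₁) (h12 : d₁ < d₂) (h21 : d₂ < 2 * d₁)
    (h23 : 2 * d₂ < d₃) (h34 : 2 * d₃ < d₄) (i : Fin 5) (p : Fin 5 × Fin 5)
    (h : (![0, d₁, d₂, d₃, d₄] : Fin 5 → ℕ) p.1 + (![0, d₁, d₂, d₃, d₄] : Fin 5 → ℕ) p.2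
      = (![0, d₁, d₂, d₃, d₄] : Fin 5 → ℕ) i + (![0, d₁, d₂, d₃, d₄] : Fin 5 → ℕ) i) : p = (i, i) := by
  obtain ⟨v0, v1, v2, v3, v4⟩ := vec5_mk_vals d₁ d₂ d₃ d₄
  obtain ⟨x, y⟩ := p
  fin_cases i <;> fin_cases x <;> fin_cases y <;>
    first | rfl | (exfalso; simp only [v0, v1, v2, v3, v4] at h; omega)

/-- On a far-top class-G support the three low PAIR knots `d₀+d₁`, `d₀+d₂`, `d₁+d₂` are uncollided. [folklore] -/
theorem farTop_pair_uncollided (d₁ d₂ d₃ d₄ : ℕ) (h1 : 0 < d₁) (h12 : d₁ < d₂) (h21 : d₂ < 2 * d₁)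
    (h23 : 2 * d₂ < d₃) (h34 : 2 * d₃ < d₄) :
    (∀ p : Fin 5 × Fin 5, (![0, d₁, d₂, d₃, d₄] : Fin 5 → ℕ) p.1 + (![0, d₁, d₂, d₃, d₄] : Fin 5 → ℕ) p.2
        = (![0, d₁, d₂, d₃, d₄] : Fin 5 → ℕ) 0 + (![0, d₁, d₂, d₃, d₄] : Fin 5 → ℕ) 1 → p = (0, 1) ∨ p = (1, 0)) ∧
    (∀ p : Fin 5 × Fin 5, (![0, d₁, d₂, d₃, d₄] : Fin 5 → ℕ) p.1 + (![0, d₁, d₂, d₃, d₄] : Fin 5 → ℕ) p.2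
        = (![0, d₁, d₂, d₃, d₄] : Fin 5 → ℕ) 0 + (![0, d₁, d₂, d₃, d₄] : Fin 5 → ℕ) 2 → p = (0, 2) ∨ p = (2, 0)) ∧
    (∀ p : Fin 5 × Fin 5, (![0, d₁, d₂, d₃, d₄] : Fin 5 → ℕ) p.1 + (![0, d₁, d₂, d₃, d₄] : Fin 5 → ℕ) p.2
        = (![0, d₁, d₂, d₃, d₄] : Fin 5 → ℕ) 1 + (![0, d₁, d₂, d₃, d₄] : Fin 5 → ℕ) 2 → p = (1, 2) ∨ p = (2, 1)) := by
  obtain ⟨v0, v1, v2, v3, v4⟩ := vec5_mk_vals d₁ d₂ d₃ d₄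
  have n0 : (![0, d₁, d₂, d₃, d₄] : Fin 5 → ℕ) 0 = 0 := rfl
  have n1 : (![0, d₁, d₂, d₃, d₄] : Fin 5 → ℕ) 1 = d₁ := rfl
  have n2 : (![0, d₁, d₂, d₃, d₄] : Fin 5 → ℕ) 2 = d₂ := rfl
  refine ⟨?_, ?_, ?_⟩ <;> rintro ⟨x, y⟩ h <;> fin_cases x <;> fin_cases y <;>
    first | decide | (exfalso; simp only [v0, v1, v2, v3, v4, n0, n1, n2] at h; omega)

/-- The fifteen formal pair sums of a far-top class-G support, listed as
`E = (0, d₁, d₂, 2d₁, d₁+d₂, 2d₂, d₃, d₁+d₃, d₂+d₃, 2d₃, d₄, d₁+d₄, d₂+d₄, d₃+d₄, 2d₄)`, are strictly increasing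
(so the support is Sidon and `E` is the sorted knot list). [folklore] -/
theorem farTop_strictMono (d₁ d₂ d₃ d₄ : ℕ) (h1 : 0 < d₁) (h12 : d₁ < d₂) (h21 : d₂ < 2 * d₁)
    (h23 : 2 * d₂ < d₃) (h34 : 2 * d₃ < d₄) :
    StrictMono (![0, d₁, d₂, 2 * d₁, d₁ + d₂, 2 * d₂, d₃, d₁ + d₃, d₂ + d₃, 2 * d₃, d₄, d₁ + d₄, d₂ + d₄,
      d₃ + d₄, 2 * d₄] : Fin 15 → ℕ) := by
  refine Fin.strictMono_iff_lt_succ.mpr ?_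
  intro i
  fin_cases i
  · show 0 < d₁; omega
  · show d₁ < d₂; omega
  · show d₂ < 2 * d₁; omega
  · show 2 * d₁ < d₁ + d₂; omega
  · show d₁ + d₂ < 2 * d₂; omega
  · show 2 * d₂ < d₃; omega
  · show d₃ < d₁ + d₃; omega
  · show d₁ + d₃ < d₂ + d₃; omega
  · show d₂ + d₃ < 2 * d₃; omega
  · show 2 * d₃ < d₄; omega
  · show d₄ < d₁ + d₄; omega
  · show d₁ + d₄ < d₂ + d₄; omega
  · show d₂ + d₄ < d₃ + d₄; omega
  · show d₃ + d₄ < 2 * d₄; omega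

/-- On a far-top class-G support the set of pair sums is the image of the sorted knot list `E`. [folklore] -/
theorem farTop_image (d₁ d₂ d₃ d₄ : ℕ) :
    (Finset.univ : Finset (Fin 15)).image (![0, d₁, d₂, 2 * d₁, d₁ + d₂, 2 * d₂, d₃, d₁ + d₃, d₂ + d₃, 2 * d₃,
        d₄, d₁ + d₄, d₂ + d₄, d₃ + d₄, 2 * d₄] : Fin 15 → ℕ)
      = (Finset.univ : Finset (Fin 5 × Fin 5)).image
          (fun p => (![0, d₁, d₂, d₃, d₄] : Fin 5 → ℕ) p.1 + (![0, d₁, d₂, d₃, d₄] : Fin 5 → ℕ) p.2) := by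
  set d : Fin 5 → ℕ := ![0, d₁, d₂, d₃, d₄] with hd_def
  set E : Fin 15 → ℕ :=
    ![0, d₁, d₂, 2 * d₁, d₁ + d₂, 2 * d₂, d₃, d₁ + d₃, d₂ + d₃, 2 * d₃, d₄, d₁ + d₄, d₂ + d₄, d₃ + d₄, 2 * d₄]
    with hE_def
  set W := (Finset.univ : Finset (Fin 5 × Fin 5)).image (fun p => d p.1 + d p.2) with hW_def
  have memW : ∀ x y : Fin 5, d x + d y ∈ W := fun x y =>
    Finset.mem_image.mpr ⟨(x, y), Finset.mem_univ _, rfl⟩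
  have memW' : ∀ x y : Fin 5, ∀ v : ℕ, v = d x + d y → v ∈ W := fun x y v hv => hv ▸ memW x y
  have hEW : ∀ i, E i ∈ W := by
    intro i
    fin_cases i
    · exact memW' 0 0 _ (by show 0 = 0 + 0; rfl)
    · exact memW' 0 1 _ (by show d₁ = 0 + d₁; omega)
    · exact memW' 0 2 _ (by show d₂ = 0 + d₂; omega)
    · exact memW' 1 1 _ (by show 2 * d₁ = d₁ + d₁; omega)
    · exact memW' 1 2 _ (by show d₁ + d₂ = d₁ + d₂; rfl)
    · exact memW' 2 2 _ (by show 2 * d₂ = d₂ + d₂; omega)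
    · exact memW' 0 3 _ (by show d₃ = 0 + d₃; omega)
    · exact memW' 1 3 _ (by show d₁ + d₃ = d₁ + d₃; rfl)
    · exact memW' 2 3 _ (by show d₂ + d₃ = d₂ + d₃; rfl)
    · exact memW' 3 3 _ (by show 2 * d₃ = d₃ + d₃; omega)
    · exact memW' 0 4 _ (by show d₄ = 0 + d₄; omega)
    · exact memW' 1 4 _ (by show d₁ + d₄ = d₁ + d₄; rfl)
    · exact memW' 2 4 _ (by show d₂ + d₄ = d₂ + d₄; rfl)
    · exact memW' 3 4 _ (by show d₃ + d₄ = d₃ + d₄; rfl)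
    · exact memW' 4 4 _ (by show 2 * d₄ = d₄ + d₄; omega)
  have hWE : ∀ x y : Fin 5, ∃ i, E i = d x + d y := by
    intro x y
    fin_cases x <;> fin_cases y
    · exact ⟨0, by show 0 = 0 + 0; rfl⟩
    · exact ⟨1, by show d₁ = 0 + d₁; omega⟩
    · exact ⟨2, by show d₂ = 0 + d₂; omega⟩
    · exact ⟨6, by show d₃ = 0 + d₃; omega⟩
    · exact ⟨10, by show d₄ = 0 + d₄; omega⟩
    · exact ⟨1, by show d₁ = d₁ + 0; omega⟩
    · exact ⟨3, by show 2 * d₁ = d₁ + d₁; omega⟩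
    · exact ⟨4, by show d₁ + d₂ = d₁ + d₂; rfl⟩
    · exact ⟨7, by show d₁ + d₃ = d₁ + d₃; rfl⟩
    · exact ⟨11, by show d₁ + d₄ = d₁ + d₄; rfl⟩
    · exact ⟨2, by show d₂ = d₂ + 0; omega⟩
    · exact ⟨4, by show d₁ + d₂ = d₂ + d₁; omega⟩
    · exact ⟨5, by show 2 * d₂ = d₂ + d₂; omega⟩
    · exact ⟨8, by show d₂ + d₃ = d₂ + d₃; rfl⟩
    · exact ⟨12, by show d₂ + d₄ = d₂ + d₄; rfl⟩
    · exact ⟨6, by show d₃ = d₃ + 0; omega⟩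
    · exact ⟨7, by show d₁ + d₃ = d₃ + d₁; omega⟩
    · exact ⟨8, by show d₂ + d₃ = d₃ + d₂; omega⟩
    · exact ⟨9, by show 2 * d₃ = d₃ + d₃; omega⟩
    · exact ⟨13, by show d₃ + d₄ = d₃ + d₄; rfl⟩
    · exact ⟨10, by show d₄ = d₄ + 0; omega⟩
    · exact ⟨11, by show d₁ + d₄ = d₄ + d₁; omega⟩
    · exact ⟨12, by show d₂ + d₄ = d₄ + d₂; omega⟩
    · exact ⟨13, by show d₃ + d₄ = d₄ + d₃; omega⟩
    · exact ⟨14, by show 2 * d₄ = d₄ + d₄; omega⟩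
  ext x
  constructor
  · intro hx
    obtain ⟨i, -, rfl⟩ := Finset.mem_image.mp hx
    exact hEW i
  · intro hx
    obtain ⟨⟨a, b⟩, -, rfl⟩ := Finset.mem_image.mp hx
    obtain ⟨i, hi⟩ := hWE a b
    exact Finset.mem_image.mpr ⟨i, Finset.mem_univ _, hi⟩

set_option maxHeartbeats 400000 in
/-- **Door B on the FAR-TOP class-G road (kernel, uniform in the support).**  Let `0 < d₁ < d₂ < 2d₁`, `2d₂ < d₃`,
`2d₃ < d₄` — a class-G `(2,5)` support `(0,d₁,d₂,d₃,d₄)` whose top letter sits above the square of the fourth; then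
the fifteen pair sums are automatically distinct (Sidon) and sorted as
`E = (0, d₁, d₂, 2d₁, d₁+d₂, 2d₂, d₃, d₁+d₃, d₂+d₃, 2d₃, d₄, d₁+d₄, d₂+d₄, d₃+d₄, 2d₄)` (every census fourteen
support of the columns `(0,2,3,·,N)`, `(0,3,4,·,N)`, `(0,3,5,·,N)` has this shape).  Suppose the NEWTON CONDITION
`M(d) ≥ 0` of THEOREM L-N (a), written with the integer weights `P_k = ∏_{j ≠ k} |E_k − E_j|` (`k = 0,…,4`) as
`P₀P₂P₃P₄ + P₁P₂²P₃ ≤ P₀P₁P₄²`.  Then every real symmetric `2 × 2` pencil on `(0,d₁,d₂,d₃,d₄)` with at least `14`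
distinct positive determinant roots (a FOURTEEN) has the word `D I I I D`:
`det S₀ > 0, det S₁ < 0, det S₂ < 0, det S₃ < 0, det S₄ > 0` — no II-ended (indeed no I-bottomed or I-topped)
fourteen: DOOR B IS EMPTY on the support.  (`Census.doorB_window_of_newtonGood` with the ranks `0,3,5,9,14` of the
square knots.)  The hypothesis `M(d) ≥ 0` is discharged uniformly on whole columns below. [folklore] -/
theorem doorB_word_farTop (d₁ d₂ d₃ d₄ : ℕ) (h1 : 0 < d₁) (h12 : d₁ < d₂) (h21 : d₂ < 2 * d₁)
    (h23 : 2 * d₂ < d₃) (h34 : 2 * d₃ < d₄)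
    (hM : let E : Fin 15 → ℕ :=
        ![0, d₁, d₂, 2 * d₁, d₁ + d₂, 2 * d₂, d₃, d₁ + d₃, d₂ + d₃, 2 * d₃, d₄, d₁ + d₄, d₂ + d₄, d₃ + d₄, 2 * d₄]
      (∏ j ∈ univ.erase (0 : Fin 15), |(E 0 : ℤ) - E j|) * (∏ j ∈ univ.erase (2 : Fin 15), |(E 2 : ℤ) - E j|)
          * (∏ j ∈ univ.erase (3 : Fin 15), |(E 3 : ℤ) - E j|) * (∏ j ∈ univ.erase (4 : Fin 15), |(E 4 : ℤ) - E j|)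
        + (∏ j ∈ univ.erase (1 : Fin 15), |(E 1 : ℤ) - E j|) * (∏ j ∈ univ.erase (2 : Fin 15), |(E 2 : ℤ) - E j|) ^ 2
          * (∏ j ∈ univ.erase (3 : Fin 15), |(E 3 : ℤ) - E j|)
      ≤ (∏ j ∈ univ.erase (0 : Fin 15), |(E 0 : ℤ) - E j|) * (∏ j ∈ univ.erase (1 : Fin 15), |(E 1 : ℤ) - E j|)
          * (∏ j ∈ univ.erase (4 : Fin 15), |(E 4 : ℤ) - E j|) ^ 2)
    (S : Fin 5 → Matrix (Fin 2) (Fin 2) ℝ) (hS : ∀ l, (S l).IsSymm)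
    (h14 : 14 ≤ ((∑ l, ((X : ℝ[X]) ^ (![0, d₁, d₂, d₃, d₄] : Fin 5 → ℕ) l) • (S l).map C).det.roots.toFinset.filter
      (fun t => 0 < t)).card) :
    0 < (S 0).det ∧ (S 1).det < 0 ∧ (S 2).det < 0 ∧ (S 3).det < 0 ∧ 0 < (S 4).det := by
  classical
  have hM₀ := hM
  dsimp only at hM₀
  clear hM
  set d : Fin 5 → ℕ := ![0, d₁, d₂, d₃, d₄] with hd_def
  set E : Fin 15 → ℕ :=
    ![0, d₁, d₂, 2 * d₁, d₁ + d₂, 2 * d₂, d₃, d₁ + d₃, d₂ + d₃, 2 * d₃, d₄, d₁ + d₄, d₂ + d₄, d₃ + d₄, 2 * d₄]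
    with hE_def
  have hE : StrictMono E := farTop_strictMono d₁ d₂ d₃ d₄ h1 h12 h21 h23 h34
  set W := (Finset.univ : Finset (Fin 5 × Fin 5)).image (fun p => d p.1 + d p.2) with hW_def
  have himage : Finset.univ.image E = W := farTop_image d₁ d₂ d₃ d₄
  have hEW : ∀ i, E i ∈ W := fun i => himage ▸ Finset.mem_image_of_mem _ (Finset.mem_univ i)
  have hcard : W.card = 15 := by
    rw [← himage, Finset.card_image_of_injective _ hE.injective]; simp
  have hEeq : (E : Fin 15 → ℕ) = W.orderEmbOfFin hcard := Finset.orderEmbOfFin_unique hcard hEW hE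
  have hrank : ∀ k : Fin 15, (W.filter (· < E k)).card = k := by
    intro k
    have := card_filter_lt_orderEmbOfFin W hcard k
    rwa [← hEeq] at this
  have usq : ∀ i : Fin 5, ∀ p : Fin 5 × Fin 5, d p.1 + d p.2 = d i + d i → p = (i, i) :=
    fun i p hp => farTop_sq_uncollided d₁ d₂ d₃ d₄ h1 h12 h21 h23 h34 i p hp
  obtain ⟨u01, u02, u12⟩ := farTop_pair_uncollided d₁ d₂ d₃ d₄ h1 h12 h21 h23 h34
  -- the knots of the window as pair sums, and their ranks
  have k00 : d 0 + d 0 = E 0 := rfl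
  have k01 : d 0 + d 1 = E 1 := by show 0 + d₁ = d₁; omega
  have k02 : d 0 + d 2 = E 2 := by show 0 + d₂ = d₂; omega
  have k11 : d 1 + d 1 = E 3 := by show d₁ + d₁ = 2 * d₁; omega
  have k12 : d 1 + d 2 = E 4 := rfl
  have k22 : d 2 + d 2 = E 5 := by show d₂ + d₂ = 2 * d₂; omega
  have k33 : d 3 + d 3 = E 9 := by show d₃ + d₃ = 2 * d₃; omega
  have k44 : d 4 + d 4 = E 14 := by show d₄ + d₄ = 2 * d₄; omega
  have hr0 : (W.filter (· < d 0 + d 0)).card = 0 := by rw [k00]; exact hrank 0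
  have hr1 : (W.filter (· < d 0 + d 1)).card = 1 := by rw [k01]; exact hrank 1
  have hr2 : (W.filter (· < d 0 + d 2)).card = 2 := by rw [k02]; exact hrank 2
  have hr3 : (W.filter (· < d 1 + d 1)).card = 3 := by rw [k11]; exact hrank 3
  have hr4 : (W.filter (· < d 1 + d 2)).card = 4 := by rw [k12]; exact hrank 4
  have hr5 : (W.filter (· < d 2 + d 2)).card = 5 := by rw [k22]; exact hrank 5
  have hr9 : (W.filter (· < d 3 + d 3)).card = 9 := by rw [k33]; exact hrank 9
  have hr14 : (W.filter (· < d 4 + d 4)).card = 14 := by rw [k44]; exact hrank 14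
  -- the Newton condition, transported from the `Fin 15` products to the `W`-products of the bridge
  have hconv : ∀ k : Fin 15, (∏ u ∈ W.erase (E k), ((Nat.dist (E k) u : ℕ) : ℤ))
      = ∏ j ∈ univ.erase k, |(E k : ℤ) - E j| := by
    intro k
    rw [← himage, ← Finset.image_erase hE.injective, Finset.prod_image hE.injective.injOn]
    exact Finset.prod_congr rfl fun u _ => intCast_natDist _ _
  have hMW : (∏ u ∈ W.erase (d 0 + d 0), Nat.dist (d 0 + d 0) u) * (∏ u ∈ W.erase (d 0 + d 2), Nat.dist (d 0 + d 2) u)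
          * (∏ u ∈ W.erase (d 1 + d 1), Nat.dist (d 1 + d 1) u) * (∏ u ∈ W.erase (d 1 + d 2), Nat.dist (d 1 + d 2) u)
        + (∏ u ∈ W.erase (d 0 + d 1), Nat.dist (d 0 + d 1) u) * (∏ u ∈ W.erase (d 0 + d 2), Nat.dist (d 0 + d 2) u) ^ 2
          * (∏ u ∈ W.erase (d 1 + d 1), Nat.dist (d 1 + d 1) u)
      ≤ (∏ u ∈ W.erase (d 0 + d 0), Nat.dist (d 0 + d 0) u) * (∏ u ∈ W.erase (d 0 + d 1), Nat.dist (d 0 + d 1) u)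
          * (∏ u ∈ W.erase (d 1 + d 2), Nat.dist (d 1 + d 2) u) ^ 2 := by
    rw [k00, k01, k02, k11, k12]
    have h : (((∏ u ∈ W.erase (E 0), Nat.dist (E 0) u) * (∏ u ∈ W.erase (E 2), Nat.dist (E 2) u)
          * (∏ u ∈ W.erase (E 3), Nat.dist (E 3) u) * (∏ u ∈ W.erase (E 4), Nat.dist (E 4) u)
        + (∏ u ∈ W.erase (E 1), Nat.dist (E 1) u) * (∏ u ∈ W.erase (E 2), Nat.dist (E 2) u) ^ 2
          * (∏ u ∈ W.erase (E 3), Nat.dist (E 3) u) : ℕ) : ℤ)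
      ≤ (((∏ u ∈ W.erase (E 0), Nat.dist (E 0) u) * (∏ u ∈ W.erase (E 1), Nat.dist (E 1) u)
          * (∏ u ∈ W.erase (E 4), Nat.dist (E 4) u) ^ 2 : ℕ) : ℤ) := by
      push_cast
      rw [hconv 0, hconv 1, hconv 2, hconv 3, hconv 4]
      exact hM₀
    exact_mod_cast h
  -- the bridge
  obtain ⟨-, hletter⟩ := doorB_window_of_newtonGood d 0 1 2 (by decide) (by decide) (by decide)
    (usq 0) (usq 1) (usq 2) u01 u02 u12 ⟨hr0, hr1, hr2, hr3, hr4, hr5⟩ hMW S hS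
    (by rw [hcard]; exact Nat.succ_le_succ h14)
  have s0 := hletter 0 (usq 0)
  have s1 := hletter 1 (usq 1)
  have s2 := hletter 2 (usq 2)
  have s3 := hletter 3 (usq 3)
  have s4 := hletter 4 (usq 4)
  rw [hr0] at s0
  rw [hr3] at s1
  rw [hr5] at s2
  rw [hr9] at s3
  rw [hr14] at s4
  norm_num at s0 s1 s2 s3 s4
  exact ⟨by linarith, by linarith, by linarith, by linarith, by linarith⟩



/-- Structured Newton weight `P_0 = ∏_{j≠0} |E_0 − E_j|` = (five low differences) · `∏_i (U_i − E_0)` over the nine upper knots. [folklore] -/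
theorem farTop_weight_0 (d₁ d₂ d₃ d₄ : ℕ) (h12 : d₁ < d₂) (h21 : d₂ < 2 * d₁)
    (h23 : 2 * d₂ < d₃) (h34 : 2 * d₃ < d₄) :
    (∏ j ∈ univ.erase (0 : Fin 15), |((![0, d₁, d₂, 2 * d₁, d₁ + d₂, 2 * d₂, d₃, d₁ + d₃, d₂ + d₃, 2 * d₃, d₄, d₁ + d₄, d₂ + d₄, d₃ + d₄, 2 * d₄] : Fin 15 → ℕ) 0 : ℤ)
        - (![0, d₁, d₂, 2 * d₁, d₁ + d₂, 2 * d₂, d₃, d₁ + d₃, d₂ + d₃, 2 * d₃, d₄, d₁ + d₄, d₂ + d₄, d₃ + d₄, 2 * d₄] : Fin 15 → ℕ) j|)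
      = ((d₁ : ℤ) * d₂ * (2 * d₁) * (d₁ + d₂) * (2 * d₂)) *
        ∏ i : Fin 9, (((![d₃, d₁ + d₃, d₂ + d₃, 2 * d₃, d₄, d₁ + d₄, d₂ + d₄, d₃ + d₄, 2 * d₄] : Fin 9 → ℕ) i : ℤ) - 0) := by
  set E : Fin 15 → ℕ := ![0, d₁, d₂, 2 * d₁, d₁ + d₂, 2 * d₂, d₃, d₁ + d₃, d₂ + d₃, 2 * d₃, d₄, d₁ + d₄, d₂ + d₄, d₃ + d₄, 2 * d₄] with hE
  set U : Fin 9 → ℕ := ![d₃, d₁ + d₃, d₂ + d₃, 2 * d₃, d₄, d₁ + d₄, d₂ + d₄, d₃ + d₄, 2 * d₄] with hU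
  rw [prod_univ_erase_eq_prod_ite_int]
  rw [Fin.prod_univ_succ, Fin.prod_univ_succ, Fin.prod_univ_succ, Fin.prod_univ_succ, Fin.prod_univ_succ,
    Fin.prod_univ_succ]
  have hup : ∀ i : Fin 9,
      (if ((((((i.succ).succ).succ).succ).succ).succ : Fin 15) = 0 then (1 : ℤ)
        else |((E 0 : ℕ) : ℤ) - E ((((((i.succ).succ).succ).succ).succ).succ)|) = (U i : ℤ) - 0 := by
    intro i
    fin_cases i <;> simp [hE, hU] <;> (rw [abs_of_nonpos (by omega)]; ring)
  rw [Finset.prod_congr rfl (fun i _ => hup i)]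
  simp [hE]
  simp (disch := omega) only [abs_of_nonpos]
  ring

/-- Structured Newton weight `P_1 = ∏_{j≠1} |E_1 − E_j|` = (five low differences) · `∏_i (U_i − E_1)` over the nine upper knots. [folklore] -/
theorem farTop_weight_1 (d₁ d₂ d₃ d₄ : ℕ) (h1 : 0 < d₁) (h12 : d₁ < d₂) (h21 : d₂ < 2 * d₁)
    (h23 : 2 * d₂ < d₃) (h34 : 2 * d₃ < d₄) :
    (∏ j ∈ univ.erase (1 : Fin 15), |((![0, d₁, d₂, 2 * d₁, d₁ + d₂, 2 * d₂, d₃, d₁ + d₃, d₂ + d₃, 2 * d₃, d₄, d₁ + d₄, d₂ + d₄, d₃ + d₄, 2 * d₄] : Fin 15 → ℕ) 1 : ℤ)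
        - (![0, d₁, d₂, 2 * d₁, d₁ + d₂, 2 * d₂, d₃, d₁ + d₃, d₂ + d₃, 2 * d₃, d₄, d₁ + d₄, d₂ + d₄, d₃ + d₄, 2 * d₄] : Fin 15 → ℕ) j|)
      = ((d₁ : ℤ) * (d₂ - d₁) * d₁ * d₂ * (2 * d₂ - d₁)) *
        ∏ i : Fin 9, (((![d₃, d₁ + d₃, d₂ + d₃, 2 * d₃, d₄, d₁ + d₄, d₂ + d₄, d₃ + d₄, 2 * d₄] : Fin 9 → ℕ) i : ℤ) - (d₁ : ℤ)) := by
  set E : Fin 15 → ℕ := ![0, d₁, d₂, 2 * d₁, d₁ + d₂, 2 * d₂, d₃, d₁ + d₃, d₂ + d₃, 2 * d₃, d₄, d₁ + d₄, d₂ + d₄, d₃ + d₄, 2 * d₄] with hE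
  set U : Fin 9 → ℕ := ![d₃, d₁ + d₃, d₂ + d₃, 2 * d₃, d₄, d₁ + d₄, d₂ + d₄, d₃ + d₄, 2 * d₄] with hU
  rw [prod_univ_erase_eq_prod_ite_int]
  rw [Fin.prod_univ_succ, Fin.prod_univ_succ, Fin.prod_univ_succ, Fin.prod_univ_succ, Fin.prod_univ_succ,
    Fin.prod_univ_succ]
  have hup : ∀ i : Fin 9,
      (if ((((((i.succ).succ).succ).succ).succ).succ : Fin 15) = 1 then (1 : ℤ)
        else |((E 1 : ℕ) : ℤ) - E ((((((i.succ).succ).succ).succ).succ).succ)|) = (U i : ℤ) - (d₁ : ℤ) := by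
    intro i
    fin_cases i <;> simp [hE, hU] <;> (rw [abs_of_nonpos (by omega)]; ring)
  rw [Finset.prod_congr rfl (fun i _ => hup i)]
  simp [hE]
  simp (disch := omega) only [abs_of_nonpos]
  ring

/-- Structured Newton weight `P_2 = ∏_{j≠2} |E_2 − E_j|` = (five low differences) · `∏_i (U_i − E_2)` over the nine upper knots. [folklore] -/
theorem farTop_weight_2 (d₁ d₂ d₃ d₄ : ℕ) (h12 : d₁ < d₂) (h21 : d₂ < 2 * d₁)
    (h23 : 2 * d₂ < d₃) (h34 : 2 * d₃ < d₄) :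
    (∏ j ∈ univ.erase (2 : Fin 15), |((![0, d₁, d₂, 2 * d₁, d₁ + d₂, 2 * d₂, d₃, d₁ + d₃, d₂ + d₃, 2 * d₃, d₄, d₁ + d₄, d₂ + d₄, d₃ + d₄, 2 * d₄] : Fin 15 → ℕ) 2 : ℤ)
        - (![0, d₁, d₂, 2 * d₁, d₁ + d₂, 2 * d₂, d₃, d₁ + d₃, d₂ + d₃, 2 * d₃, d₄, d₁ + d₄, d₂ + d₄, d₃ + d₄, 2 * d₄] : Fin 15 → ℕ) j|)
      = ((d₂ : ℤ) * (d₂ - d₁) * (2 * d₁ - d₂) * d₁ * d₂) *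
        ∏ i : Fin 9, (((![d₃, d₁ + d₃, d₂ + d₃, 2 * d₃, d₄, d₁ + d₄, d₂ + d₄, d₃ + d₄, 2 * d₄] : Fin 9 → ℕ) i : ℤ) - (d₂ : ℤ)) := by
  set E : Fin 15 → ℕ := ![0, d₁, d₂, 2 * d₁, d₁ + d₂, 2 * d₂, d₃, d₁ + d₃, d₂ + d₃, 2 * d₃, d₄, d₁ + d₄, d₂ + d₄, d₃ + d₄, 2 * d₄] with hE
  set U : Fin 9 → ℕ := ![d₃, d₁ + d₃, d₂ + d₃, 2 * d₃, d₄, d₁ + d₄, d₂ + d₄, d₃ + d₄, 2 * d₄] with hU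
  rw [prod_univ_erase_eq_prod_ite_int]
  rw [Fin.prod_univ_succ, Fin.prod_univ_succ, Fin.prod_univ_succ, Fin.prod_univ_succ, Fin.prod_univ_succ,
    Fin.prod_univ_succ]
  have hup : ∀ i : Fin 9,
      (if ((((((i.succ).succ).succ).succ).succ).succ : Fin 15) = 2 then (1 : ℤ)
        else |((E 2 : ℕ) : ℤ) - E ((((((i.succ).succ).succ).succ).succ).succ)|) = (U i : ℤ) - (d₂ : ℤ) := by
    intro i
    fin_cases i <;> simp [hE, hU] <;> (rw [abs_of_nonpos (by omega)]; ring)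
  rw [Finset.prod_congr rfl (fun i _ => hup i)]
  simp [hE]
  simp (disch := omega) only [abs_of_nonneg, abs_of_nonpos]
  ring

/-- Structured Newton weight `P_3 = ∏_{j≠3} |E_3 − E_j|` = (five low differences) · `∏_i (U_i − E_3)` over the nine upper knots. [folklore] -/
theorem farTop_weight_3 (d₁ d₂ d₃ d₄ : ℕ) (h1 : 0 < d₁) (h12 : d₁ < d₂) (h21 : d₂ < 2 * d₁)
    (h23 : 2 * d₂ < d₃) (h34 : 2 * d₃ < d₄) :
    (∏ j ∈ univ.erase (3 : Fin 15), |((![0, d₁, d₂, 2 * d₁, d₁ + d₂, 2 * d₂, d₃, d₁ + d₃, d₂ + d₃, 2 * d₃, d₄, d₁ + d₄, d₂ + d₄, d₃ + d₄, 2 * d₄] : Fin 15 → ℕ) 3 : ℤ)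
        - (![0, d₁, d₂, 2 * d₁, d₁ + d₂, 2 * d₂, d₃, d₁ + d₃, d₂ + d₃, 2 * d₃, d₄, d₁ + d₄, d₂ + d₄, d₃ + d₄, 2 * d₄] : Fin 15 → ℕ) j|)
      = (2 * (d₁ : ℤ) * d₁ * (2 * d₁ - d₂) * (d₂ - d₁) * (2 * d₂ - 2 * d₁)) *
        ∏ i : Fin 9, (((![d₃, d₁ + d₃, d₂ + d₃, 2 * d₃, d₄, d₁ + d₄, d₂ + d₄, d₃ + d₄, 2 * d₄] : Fin 9 → ℕ) i : ℤ) - (2 * d₁ : ℤ)) := by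
  set E : Fin 15 → ℕ := ![0, d₁, d₂, 2 * d₁, d₁ + d₂, 2 * d₂, d₃, d₁ + d₃, d₂ + d₃, 2 * d₃, d₄, d₁ + d₄, d₂ + d₄, d₃ + d₄, 2 * d₄] with hE
  set U : Fin 9 → ℕ := ![d₃, d₁ + d₃, d₂ + d₃, 2 * d₃, d₄, d₁ + d₄, d₂ + d₄, d₃ + d₄, 2 * d₄] with hU
  rw [prod_univ_erase_eq_prod_ite_int]
  rw [Fin.prod_univ_succ, Fin.prod_univ_succ, Fin.prod_univ_succ, Fin.prod_univ_succ, Fin.prod_univ_succ,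
    Fin.prod_univ_succ]
  have hup : ∀ i : Fin 9,
      (if ((((((i.succ).succ).succ).succ).succ).succ : Fin 15) = 3 then (1 : ℤ)
        else |((E 3 : ℕ) : ℤ) - E ((((((i.succ).succ).succ).succ).succ).succ)|) = (U i : ℤ) - (2 * d₁ : ℤ) := by
    intro i
    fin_cases i <;> simp [hE, hU] <;> (rw [abs_of_nonpos (by omega)]; ring)
  rw [Finset.prod_congr rfl (fun i _ => hup i)]
  simp [hE]
  simp (disch := omega) only [abs_of_nonneg, abs_of_nonpos]
  ring

/-- Structured Newton weight `P_4 = ∏_{j≠4} |E_4 − E_j|` = (five low differences) · `∏_i (U_i − E_4)` over the nine upper knots. [folklore] -/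
theorem farTop_weight_4 (d₁ d₂ d₃ d₄ : ℕ) (h12 : d₁ < d₂) (h21 : d₂ < 2 * d₁)
    (h23 : 2 * d₂ < d₃) (h34 : 2 * d₃ < d₄) :
    (∏ j ∈ univ.erase (4 : Fin 15), |((![0, d₁, d₂, 2 * d₁, d₁ + d₂, 2 * d₂, d₃, d₁ + d₃, d₂ + d₃, 2 * d₃, d₄, d₁ + d₄, d₂ + d₄, d₃ + d₄, 2 * d₄] : Fin 15 → ℕ) 4 : ℤ)
        - (![0, d₁, d₂, 2 * d₁, d₁ + d₂, 2 * d₂, d₃, d₁ + d₃, d₂ + d₃, 2 * d₃, d₄, d₁ + d₄, d₂ + d₄, d₃ + d₄, 2 * d₄] : Fin 15 → ℕ) j|)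
      = (((d₁ : ℤ) + d₂) * d₂ * d₁ * (d₂ - d₁) * (d₂ - d₁)) *
        ∏ i : Fin 9, (((![d₃, d₁ + d₃, d₂ + d₃, 2 * d₃, d₄, d₁ + d₄, d₂ + d₄, d₃ + d₄, 2 * d₄] : Fin 9 → ℕ) i : ℤ) - ((d₁ : ℤ) + d₂)) := by
  set E : Fin 15 → ℕ := ![0, d₁, d₂, 2 * d₁, d₁ + d₂, 2 * d₂, d₃, d₁ + d₃, d₂ + d₃, 2 * d₃, d₄, d₁ + d₄, d₂ + d₄, d₃ + d₄, 2 * d₄] with hE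
  set U : Fin 9 → ℕ := ![d₃, d₁ + d₃, d₂ + d₃, 2 * d₃, d₄, d₁ + d₄, d₂ + d₄, d₃ + d₄, 2 * d₄] with hU
  rw [prod_univ_erase_eq_prod_ite_int]
  rw [Fin.prod_univ_succ, Fin.prod_univ_succ, Fin.prod_univ_succ, Fin.prod_univ_succ, Fin.prod_univ_succ,
    Fin.prod_univ_succ]
  have hup : ∀ i : Fin 9,
      (if ((((((i.succ).succ).succ).succ).succ).succ : Fin 15) = 4 then (1 : ℤ)
        else |((E 4 : ℕ) : ℤ) - E ((((((i.succ).succ).succ).succ).succ).succ)|) = (U i : ℤ) - ((d₁ : ℤ) + d₂) := by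
    intro i
    fin_cases i <;> simp [hE, hU] <;> (rw [abs_of_nonpos (by omega)]; ring)
  rw [Finset.prod_congr rfl (fun i _ => hup i)]
  simp [hE]
  simp (disch := omega) only [abs_of_nonneg, abs_of_nonpos]
  ring

end Summit.ValiantsHypothesis.ValiantsHypothesis.Theorems.LacunarySymmetroidMatrixDescartes.Census
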